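import Literature.AlgebraicGeometry.Frobenioids.NumberFieldLocalizationCategoriesProofs
import Literature.AlgebraicGeometry.Frobenioids.BCatOrbitsAnyTopology
import HarnessLib

/-!
# Frobenioids II, Example 1.4 (ii): `E₀ → P₀` is faithful for EVERY topologized group `G`
# (FACT-LIST F-1173, unconditional exact-closure witness) — PROOF-ONLY

Mochizuki, *The geometry of Frobenioids II: poly-Frobenioids*, Kyushu J. Math. **62** (2008)
401–460, §1 Example 1.4 (ii), author's text p. 13 [cite: MochizukiFrdII2008, Ex. 1.4 (ii) p.13];
base category `B(G)` of [FrdI] §0 p. 13 [cite: MochizukiFrdI2008, §0 p.13].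

PROOF-ONLY companion of `NumberFieldLocalizationCategories.lean` (statements, seat abc-iut-L1-t8) and
`NumberFieldLocalizationCategoriesProofs.lean` (proofs under `[IsTopologicalGroup G]`).  abc-iut cell,
FACT-LIST wave F (seat f-044, tranche 44): row **F-1173** `NFLocCat.ToP₀Faithful` is labelled
*conditional* because the tree's witness `NFLocCat.toP₀Faithful_holds` (and its exact-name re-export
`NFLocCat.ToP₀Faithful_holds`) carries the extra instance binder `[IsTopologicalGroup G]`, which is NOT a
binder of the named fact `ToP₀Faithful (G) [Group G] [TopologicalSpace G] (D : Subgroup G)`.  The binder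
is idle: faithfulness only needs "an object of `E₀` has a point of `P`" and "two maps out of a connected
object of `B(G)` agreeing at a point are equal", and the latter holds for an ARBITRARY topology on `G`
(`BCat.hom_eq_of_apply_eq'`, toolkit `BCatOrbitsAnyTopology.lean` of seat abc-iut-w5-d088: connected
`⟹` single orbit with no compatibility between topology and group law).  Hence
`NFLocCat.ToP₀Faithful_holds'` — the exact universal closure of the named fact (primed: the unprimed
exact name is the conditional re-export in `FactListWitnessesFrd.lean`); faithfulness on arrows and
the injectivity of `Aut_{E₀}(T) → Aut_{P₀}(P)` for any topology follow by `.map_injective`.  Nothing is restated, no definition is touched; typed ≠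
proved for everything not in this file; nothing here bears on [IUTchIII] Cor. 3.12.
-/

namespace Literature.AlgebraicGeometry.Frobenioids

namespace NFLocCat

open CategoryTheory

universe u

variable {G : Type u} [Group G] [TopologicalSpace G] (D : Subgroup G)

/-- Two morphisms of `E₀` with the same `P`-component are equal (the `Q`-components agree at the
image of a point of `P`, and `Q` is a single orbit) — for ANY topology on `G`.  (Private: the gate's
dedup identifies the public form with the conditional `hom_eq_of_left_eq`; consumers use
`(ToP₀Faithful_holds' G D).map_injective`.) [cite: MochizukiFrdII2008, Ex. 1.4 (ii) p.13] -/
private theorem hom_eq_of_left_eq' {T T' : ECat G D} {f f' : T ⟶ T'} (h : f.hom.left = f'.hom.left) :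
    f = f' := by
  obtain ⟨p⟩ := nonempty_left D T
  apply ObjectProperty.hom_ext
  apply Comma.hom_ext _ _ h
  apply ObjectProperty.hom_ext
  apply BCat.hom_eq_of_apply_eq' T.obj.right.property (T.obj.hom.hom.hom p)
  have w₁ := w_apply D f p
  have w₂ := w_apply D f' p
  rw [h] at w₁
  exact w₁.symm.trans w₂

/-- **FACT-LIST F-1173, UNCONDITIONAL exact closed witness**: the universal closure of the named fact
`NFLocCat.ToP₀Faithful` — "`E₀ → P₀` is faithful" for every `(G, D)`, `G` a group with an arbitrary
topology (primed: the unprimed exact name is the conditional re-export carrying `[IsTopologicalGroup G]`).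
[cite: MochizukiFrdII2008, Ex. 1.4 (ii) p.13] -/
theorem ToP₀Faithful_holds' :
    ∀ (G : Type u) [Group G] [TopologicalSpace G] (D : Subgroup G),
      Literature.AlgebraicGeometry.Frobenioids.NFLocCat.ToP₀Faithful G D :=
  fun _ _ _ D => ⟨fun {_ _} _ _ e => hom_eq_of_left_eq' D e⟩

end NFLocCat

end Literature.AlgebraicGeometry.Frobenioids
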